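import Literature.AlgebraicGeometry.Hyperkaehler.K3HilbertKummerLatticePolarisationOrbits
import HarnessLib

/-!
# Apostolov's example: one polarisation type, two monodromy orbits — `K3^{[166]}`-type, `2d = 30`, divisibility `15`
# (A. Apostolov, *Moduli spaces of polarized irreducible symplectic manifolds are not necessarily connected*,
# Ann. Inst. Fourier 64 (2014), §2 Cor. 2.4–2.5 and Remark (1))

Layer `Literature/AlgebraicGeometry/Hyperkaehler`. Written for lane `lit-hodgefound` (Track 2 foundations; prover seat
`lit-hodgefound-p18`, gen 46, row g46-#14). THEOREMS ONLY — no definition, no named fact, no instance, no notation. Sequel of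
§4, §10 and §11 of `K3HilbertKummerLatticePolarisationOrbits.lean` (the `O(Λ_n)`-, `O⁺(Λ_n)`- and `Mon² = π⁻¹{±1} ∩ O⁺(Λ_n)`-orbits of
primitive `h ∈ Λ_n = Λ(K3^{[n]})` with `h² = 2d`, `(h, Λ_n) = fℤ`, counted by the admissible classes
`{c mod f : (c, f) = 1, f² ∣ d + (n−1)c²}` modulo the units `σ² ≡ 1 (mod 4(n−1))` resp. modulo sign).

## Source, verbatim (A. Apostolov, Ann. Inst. Fourier 64 (2014) 189–202, §2–§3; held text `paper:arxiv-1109.0175` p. 10)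

"**Corollary 2.4.** The number of connected components of the moduli space of polarized IS manifolds of `K3^{[n]}`-type, with
polarization type of degree `2d` and divisibility `t`, is given by `|Σ_n^{d,t}|`. […] **Remarks.** (1) In particular, Cor. 2.5
implies that the moduli space of polarized IS manifolds of `K3^{[2]}`-type, with fixed polarization type, is connected. However,
the following example shows that fixing the polarization type need not imply connectedness of the moduli space. Let `d = pq` and
`n − 1 = mpq`, where `p` and `q` are different primes, and `−m` is a quadratic residue modulo `pq`. Set `t = pq`. In this case, the
polarization type is determined by `t` and `d`, since `(2m, 2) = 2` and `t = pq` are coprime. But `|Σ_n^{d,t}| = 2`, i.e. there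
are two connected components with this polarization type."

## Reading notes

* We take the smallest instance of the printed family: `p = 3`, `q = 5`, `m = 11` (`−11 ≡ 4 = 2²` is a quadratic residue mod
  `15`), so `n − 1 = 165`, `n = 166`, `2d = 30`, `t = f = 15`; `Λ_166 = Λ_{K3} ⊕ ⟨−330⟩`. The admissible classes
  `{c mod 15 : (c, 15) = 1, 225 ∣ 15 + 165c²}` are `c ∈ {2, 7, 8, 13}` (`c² ≡ 4 mod 15`).
* "polarization type" = `O(Λ_n)`-orbit (Apostolov p. 3: "`h̄` the `O(Λ)`-orbit determined by `h`"); by GHS Cor. 4.7 (`w = 1` here) it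
  is also one `O⁺(Λ_n)`-orbit (§11 `…_isOrientationPreserving_…`). "connected components" = `Mon²(Λ_n)`-orbits (Apostolov Thm. 1.7 with
  Markman); in the tree `Mon²` is the lattice group `π⁻¹{±1} ∩ O⁺(Λ_n)` of §11 (Markman's Lemma 9.2, not in the tree, identifies it
  with `Mon²(K3^{[n]})`), whose orbits are the classes `c mod f` up to sign: `{2, 13}` and `{7, 8}` — TWO — while the units
  `σ ∈ {1, 109, 221, 329} mod 330` (`σ² ≡ 1 mod 660`) act transitively on `{2, 7, 8, 13}` — ONE `O⁺(Λ_166)`-orbit.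

## Contents (all proved)

* `k3Hilbert166_natCard_quot_isometryEquiv_isOrientationPreserving_of_divisor_fifteen`: ONE `O⁺(Λ_166)`-orbit of primitive `h`
  with `h² = 30`, `(h, Λ_166) = 15ℤ` (one polarisation type);
* **`k3Hilbert166_natCard_quot_sign_isometryEquiv_isOrientationPreserving_of_divisor_fifteen`**: TWO orbits of the same vectors
  under `π⁻¹{±1} ∩ O⁺(Λ_166)` ("two connected components with this polarization type").

## References

* [Apostolov2014NotConnected] A. Apostolov, Moduli spaces of polarized irreducible symplectic manifolds are not necessarily
  connected, Ann. Inst. Fourier 64 (2014) 189–202 (arXiv:1109.0175): Cor. 2.4, Cor. 2.5, Remark (1).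
* [GritsenkoHulekSankaran2010Symplectic] V. Gritsenko, K. Hulek, G. K. Sankaran, Compositio Math. 146 (2010): §3 Thm. 3.3, Question
  3.6; §4 Prop. 4.6, Cor. 4.7.
* [Markman2011Survey] E. Markman, Springer Proc. Math. 8 (2011): §9.1.1 Lemma 9.2.
-/

noncomputable section

open Module Function
open LinearMap (BilinForm)
open LinearMap.BilinForm
open Literature.Topology.FourManifolds Literature.AlgebraicGeometry.Surfaces

namespace Literature.AlgebraicGeometry.Hyperkaehler

/-- The admissible classes for `n = 166`, `d = 15`, `f = 15`: `225 ∣ 15 + 165c²` forces `c ≡ 2, 7, 8, 13 (mod 15)`.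
[cite: Apostolov2014NotConnected, §3 Remark (1)] -/
private theorem val_eq_of_mem (c : {c : ZMod 15 // IsUnit c ∧ ((15 : ℕ) : ℤ) ^ 2 ∣ 15 + ((166 - 1 : ℕ) : ℤ) * (c.val : ℤ) ^ 2}) :
    c.1 = 2 ∨ c.1 = 7 ∨ c.1 = 8 ∨ c.1 = 13 := by
  obtain ⟨c, -, hd⟩ := c
  change c = 2 ∨ c = 7 ∨ c = 8 ∨ c = 13
  have hlt : c.val < 15 := c.val_lt
  rw [← ZMod.natCast_zmod_val c]
  interval_cases h : c.val <;> norm_num at hd <;> decide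

/-- The four admissible classes are admissible. [cite: Apostolov2014NotConnected, §3 Remark (1)] -/
private theorem mem_of_eq {c : ZMod 15} (h : c = 2 ∨ c = 7 ∨ c = 8 ∨ c = 13) :
    IsUnit c ∧ ((15 : ℕ) : ℤ) ^ 2 ∣ 15 + ((166 - 1 : ℕ) : ℤ) * (c.val : ℤ) ^ 2 := by
  rcases h with rfl | rfl | rfl | rfl
  · exact ⟨IsUnit.of_mul_eq_one (8 : ZMod 15) (by decide), by decide⟩
  · exact ⟨IsUnit.of_mul_eq_one (13 : ZMod 15) (by decide), by decide⟩
  · exact ⟨IsUnit.of_mul_eq_one (2 : ZMod 15) (by decide), by decide⟩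
  · exact ⟨IsUnit.of_mul_eq_one (7 : ZMod 15) (by decide), by decide⟩

/-- For each admissible `c` there is a unit `σ` of the discriminant form (`σ² ≡ 1 mod 660`) with `σ·2 ≡ c (mod 15)`:
`σ ∈ {1, 221, 109, 329}`. [cite: Apostolov2014NotConnected, §3 Remark (1) ("the polarization type is determined by t and d")] -/
private theorem exists_unit_two_mul_eq {c : ZMod 15} (h : c = 2 ∨ c = 7 ∨ c = 8 ∨ c = 13) :
    ∃ σ : ℤ, (660 : ℤ) ∣ σ ^ 2 - 1 ∧ (σ : ZMod 15) * 2 = c := by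
  rcases h with rfl | rfl | rfl | rfl
  · exact ⟨1, by norm_num, by decide⟩
  · exact ⟨221, by norm_num, by decide⟩
  · exact ⟨109, by norm_num, by decide⟩
  · exact ⟨329, by norm_num, by decide⟩

/-- … and one with `σ·c ≡ 2 (mod 15)`. [cite: Apostolov2014NotConnected, §3 Remark (1)] -/
private theorem exists_unit_mul_eq_two {c : ZMod 15} (h : c = 2 ∨ c = 7 ∨ c = 8 ∨ c = 13) :
    ∃ σ : ℤ, (660 : ℤ) ∣ σ ^ 2 - 1 ∧ (σ : ZMod 15) * c = 2 := by
  rcases h with rfl | rfl | rfl | rfl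
  · exact ⟨1, by norm_num, by decide⟩
  · exact ⟨221, by norm_num, by decide⟩
  · exact ⟨109, by norm_num, by decide⟩
  · exact ⟨329, by norm_num, by decide⟩

/-- **One polarisation type**: in `Λ_166 = Λ(K3^{[166]})` the primitive vectors `h` with `h² = 30` and `(h, Λ_166) = 15ℤ` form
exactly ONE `O⁺(Λ_166)`-orbit ("the polarization type is determined by `t` and `d`, since `(2m, 2) = 2` and `t = pq` are
coprime" — `p = 3`, `q = 5`, `m = 11`). [cite: Apostolov2014NotConnected, §3 Remark (1)] [cite: GritsenkoHulekSankaran2010Symplectic, §4 Cor. 4.7 and §3] -/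
theorem k3Hilbert166_natCard_quot_isometryEquiv_isOrientationPreserving_of_divisor_fifteen :
    Nat.card (Quot fun r s : {r : K3HilbertIndex → ℤ // Matrix.toBilin' (k3HilbertGram 166) r r = 2 * 15 ∧ r ≠ 0 ∧
        (∀ (k : ℤ) (w : K3HilbertIndex → ℤ), k ≠ 0 → k • w ∈ ℤ ∙ r → w ∈ ℤ ∙ r) ∧
        (∀ z, ((15 : ℕ) : ℤ) ∣ Matrix.toBilin' (k3HilbertGram 166) r z) ∧
        ∃ r', Matrix.toBilin' (k3HilbertGram 166) r r' = (15 : ℕ)} ↦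
      ∃ g : (Matrix.toBilin' (k3HilbertGram 166)).IsometryEquiv (Matrix.toBilin' (k3HilbertGram 166)),
        g.IsOrientationPreserving ∧ g r.1 = s.1) = 1 := by
  rw [k3Hilbert_natCard_quot_isometryEquiv_isOrientationPreserving_of_divisor (n := 166) (by norm_num) 15 (f := 15)
    (by norm_num) (by norm_num)]
  haveI : Subsingleton (Quot fun c c' : {c : ZMod 15 // IsUnit c ∧ ((15 : ℕ) : ℤ) ^ 2 ∣ 15 + ((166 - 1 : ℕ) : ℤ) * (c.val : ℤ) ^ 2} ↦
      ∃ σ : ℤ, (4 * (166 - 1 : ℕ) : ℤ) ∣ σ ^ 2 - 1 ∧ (c'.1 : ZMod 15) = (σ : ZMod 15) * c.1) :=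
    ⟨by
      rintro ⟨c⟩ ⟨c'⟩
      refine Quot.sound ?_
      obtain ⟨σ, hσ, hσc⟩ := exists_unit_mul_eq_two (val_eq_of_mem c)
      obtain ⟨τ, hτ, hτc⟩ := exists_unit_two_mul_eq (val_eq_of_mem c')
      refine ⟨τ * σ, ?_, ?_⟩
      · have h1 : (τ * σ) ^ 2 - 1 = (τ ^ 2 - 1) * σ ^ 2 + (σ ^ 2 - 1) := by ring
        rw [h1]
        norm_num
        exact dvd_add (dvd_mul_of_dvd_left hτ _) hσ
      · rw [Int.cast_mul, mul_assoc, hσc, hτc]⟩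
  haveI : Nonempty (Quot fun c c' : {c : ZMod 15 // IsUnit c ∧ ((15 : ℕ) : ℤ) ^ 2 ∣ 15 + ((166 - 1 : ℕ) : ℤ) * (c.val : ℤ) ^ 2} ↦
      ∃ σ : ℤ, (4 * (166 - 1 : ℕ) : ℤ) ∣ σ ^ 2 - 1 ∧ (c'.1 : ZMod 15) = (σ : ZMod 15) * c.1) :=
    ⟨Quot.mk _ ⟨2, mem_of_eq (Or.inl rfl)⟩⟩
  exact Nat.card_unique

/-- **… but two monodromy orbits**: the same vectors form exactly TWO orbits under `π⁻¹{±1} ∩ O⁺(Λ_166)` (Markman's `Mon²(K3^{[166]})`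
by Lemma 9.2) — the classes `{2, 13}` and `{7, 8}` of `c mod 15` up to sign: "`|Σ_n^{d,t}| = 2`, i.e. there are two connected
components with this polarization type" (`d = 15`, `n − 1 = 11·15`, `t = 15`). [cite: Apostolov2014NotConnected, §2 Cor. 2.4 and §3 Remark (1)] [cite: Markman2011Survey, §9.1.1 Lemma 9.2] [cite: GritsenkoHulekSankaran2010Symplectic, §3 Thm. 3.3 and Question 3.6] -/
theorem k3Hilbert166_natCard_quot_sign_isometryEquiv_isOrientationPreserving_of_divisor_fifteen :
    Nat.card (Quot fun r s : {r : K3HilbertIndex → ℤ // Matrix.toBilin' (k3HilbertGram 166) r r = 2 * 15 ∧ r ≠ 0 ∧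
        (∀ (k : ℤ) (w : K3HilbertIndex → ℤ), k ≠ 0 → k • w ∈ ℤ ∙ r → w ∈ ℤ ∙ r) ∧
        (∀ z, ((15 : ℕ) : ℤ) ∣ Matrix.toBilin' (k3HilbertGram 166) r z) ∧
        ∃ r', Matrix.toBilin' (k3HilbertGram 166) r r' = (15 : ℕ)} ↦
      ∃ g : (Matrix.toBilin' (k3HilbertGram 166)).IsometryEquiv (Matrix.toBilin' (k3HilbertGram 166)),
        ((∀ a, g.discriminantGroupCongr a = a) ∨ (∀ a, g.discriminantGroupCongr a = -a)) ∧ g.IsOrientationPreserving ∧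
          g r.1 = s.1) = 2 := by
  rw [k3Hilbert_natCard_quot_sign_isometryEquiv_isOrientationPreserving_of_divisor (n := 166) (by norm_num) 15 (f := 15)
    (by norm_num) (by norm_num)]
  set S := {c : ZMod 15 // IsUnit c ∧ ((15 : ℕ) : ℤ) ^ 2 ∣ 15 + ((166 - 1 : ℕ) : ℤ) * (c.val : ℤ) ^ 2} with hS
  set R : S → S → Prop := fun c c' ↦ (c'.1 : ZMod 15) = c.1 ∨ (c'.1 : ZMod 15) = -c.1 with hR
  have hequiv : Equivalence R :=
    { refl := fun c ↦ Or.inl rfl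
      symm := by
        rintro c c' (h | h)
        · exact Or.inl h.symm
        · exact Or.inr (by rw [h, neg_neg])
      trans := by
        rintro c c' c'' (h | h) (h' | h')
        · exact Or.inl (h'.trans h)
        · exact Or.inr (by rw [h', h])
        · exact Or.inr (by rw [h', h])
        · exact Or.inl (by rw [h', h, neg_neg]) }
  let c₂ : S := ⟨2, mem_of_eq (Or.inl rfl)⟩
  let c₇ : S := ⟨7, mem_of_eq (Or.inr (Or.inl rfl))⟩
  rw [Nat.card_eq_two_iff]
  refine ⟨Quot.mk R c₂, Quot.mk R c₇, fun h ↦ ?_, ?_⟩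
  · have h1 : R c₂ c₇ := hequiv.eqvGen_iff.1 (Quot.eqvGen_exact h)
    rcases h1 with h1 | h1
    · exact absurd (h1 : (7 : ZMod 15) = 2) (by decide)
    · exact absurd (h1 : (7 : ZMod 15) = -2) (by decide)
  · rw [Set.eq_univ_iff_forall]
    rintro ⟨c⟩
    change Quot.mk R c ∈ ({Quot.mk R c₂, Quot.mk R c₇} : Set (Quot R))
    rw [Set.mem_insert_iff, Set.mem_singleton_iff]
    rcases val_eq_of_mem c with h | h | h | h
    · exact Or.inl (Quot.sound (Or.inl (show (2 : ZMod 15) = c.1 from h.symm)))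
    · exact Or.inr (Quot.sound (Or.inl (show (7 : ZMod 15) = c.1 from h.symm)))
    · exact Or.inr (Quot.sound (Or.inr (show (7 : ZMod 15) = -c.1 by rw [h]; decide)))
    · exact Or.inl (Quot.sound (Or.inr (show (2 : ZMod 15) = -c.1 by rw [h]; decide)))

end Literature.AlgebraicGeometry.Hyperkaehler

end
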